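import Summits.Ventures.LatticeQCDFlow.Exactness.FlowSamplerGroupSymmetrisationTauInt
import Summits.Ventures.LatticeQCDFlow.Exactness.Phi4LatticeSymmetry
import HarnessLib

/-!
# AVERAGING A FLOW OVER THE LATTICE SYMMETRY GROUP OF φ⁴ IS FREE: acceptance, ESS and mode-collapse guarantees, and `τ_int` never increases for any invariant or sign-covariant polynomial observable

HONEST FRAMING: exact (Metropolis-corrected) sampling algorithms for lattice gauge theory;
figures of merit are autocorrelation/cost numbers at stated couplings and volumes; no
continuum-physics claim.  (SCALAR calibration rung S0-A: not a gauge result.)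

Venture `LatticeQCDFlow` (cell pub-lqcd), topic `Exactness`; FANOUT row 2 (`s0-phi4`, FLOW arm
`imhOpPhi4 J λ q̃`: every `λ > 0`, every real coupling matrix `J`, EVERY positive measurable model
density `q̃` with `∫ q̃ = 1`).  NEW WORK of the cell — the lattice instances gen-22 listed as missing
('beyond `Z₂` they need symmetric couplings'): let a finite group `G` act on `ℝ^Λ` through a pair of
homomorphisms `ρ : G →* Sym(Λ)`, `ε : G →* ℤˣ` by the signed site symmetries
`t_a = latticeSymm (ρ a) (ε a)` (`(t_a φ)_x = ε(a)·φ_{ρ(a)⁻¹ x}`, file `Phi4LatticeSymmetry`), every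
`ρ(a)` preserving the couplings (`J_{ρ(a)x, ρ(a)y} = J_{xy}`) — translations, rotations, reflections
of a periodic card, with or without the global flip.  The AVERAGED flow proposes from `q̃` and applies
a uniformly random `t_a⁻¹`; its density is `q̄ = |G|⁻¹ Σ_a q̃ ∘ t_a` (the 'single-model symmetrized
mixture' of Boyda et al. 2021 / Hackett et al. 2021 §4.2, NAMED).  Everything below is the tree's
general theory (`FlowSamplerGroupSymmetrisation`, `…Dirichlet`, `…TauInt`) with its three hypotheses
discharged by `measurePreserving_latticeSymm`, `gibbsWeight_latticeSymm`, `latticeSymm_hom_mul`.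
Nothing is cited as a fact.

## What is proved (`λ > 0`, real `J`, `ρ(a)` `J`-automorphisms, any positive normalised `q̃`)

* `phi4LatticeAvg_meanRejection_le` — the mean acceptance never drops; `phi4LatticeAvg_weightMoment_le`
  — `W₂(q̄) ≤ W₂(q̃)` (the i.i.d. effective sample size never drops);
* **`phi4LatticeAvg_tauInt_le_of_orbitCover`** — ORBIT COVER `∀ φ ∃ a, e^{−S(φ)} ≤ C q̃(t_a φ)` ⇒
  every centred `PolyObs` observable has a summable series under the averaged arm with
  `τ_int ≤ |G| C/Z − ½` (a flow covering ONE translate/reflection/sign of every configuration samples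
  all of them: translation-mode collapse priced);
* `gibbsExpect_comp_latticeSymm` — `⟨f ∘ t_{(σ,c)}⟩ = ⟨f⟩`;
* **`phi4LatticeAvg_tauInt_le_of_covariant`** — for every `f ∈ PolyObs` with `f ∘ t_a = χ(a)·f`
  (`χ` multiplicative, `χ² = 1`) and `Var f > 0`: a summable series under the flow arm stays summable
  under the averaged arm and **`τ_int^{q̄}(f) ≤ τ_int^{q̃}(f)`**;
* **`phi4LatticeAvg_tauInt_le_of_invariant`** — the same for every INVARIANT `f ∈ PolyObs` (the energy
  parts `Σ φJφ`, `Σ φ⁴`, `Σ φ²`, `M²`; `M` itself when `ε ≡ 1`);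
* **`phi4LatticeAvg_tauInt_magnetisation_le`** — and for the MAGNETISATION under ANY such group (it is
  in the sign sector `χ = ε`).

NOT CLAIMED: any value of an acceptance, `W₂`, `C`, `τ_int` for any run or network; which permutations
preserve a given card's `J`; per-cost statements (`|G|` density evaluations per proposal unless the
flow is equivariant — then `q̄ = q̃` and nothing changes); mixed-representation observables (false in
general: `FlowSamplerSymmetrisationMixedParity`); HMC / local arms.
-/

namespace Summit.Ventures.LatticeQCDFlow.Exactness

open Real MeasureTheory Filter Finset Set Topology
open Summit.Ventures.LatticeQCDFlow.Scoring

section Lattice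

variable {n : ℕ} {G : Type*} [Group G] [Fintype G]

/-! ## §0 The three hypotheses of the general theory, discharged -/

omit [Fintype G] in
/-- Every `t_a = latticeSymm (ρ a) (ε a)` preserves Lebesgue measure. -/
theorem latticeSymm_family_measurePreserving (ρ : G →* Equiv.Perm (Fin (n + 1))) (ε : G →* ℤˣ) :
    ∀ a : G, MeasurePreserving (latticeSymm (ρ a) (ε a)) volume volume :=
  fun a => measurePreserving_latticeSymm (ρ a) (ε a)

omit [Fintype G] in
/-- The Gibbs weight is invariant under every `t_a` (`ρ(a)` a `J`-automorphism). -/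
theorem latticeSymm_family_gibbsWeight {J : Fin (n + 1) → Fin (n + 1) → ℝ}
    {ρ : G →* Equiv.Perm (Fin (n + 1))} (hJ : ∀ a x y, J (ρ a x) (ρ a y) = J x y) (ε : G →* ℤˣ)
    (lam : ℝ) : ∀ (a : G) (φ : Fin (n + 1) → ℝ),
      gibbsWeight J lam (latticeSymm (ρ a) (ε a) φ) = gibbsWeight J lam φ :=
  fun a φ => gibbsWeight_latticeSymm (hJ a) (ε a) lam φ

omit [Fintype G] in
/-- The group law `t_{ab} = t_a ∘ t_b`. -/
theorem latticeSymm_family_mul (ρ : G →* Equiv.Perm (Fin (n + 1))) (ε : G →* ℤˣ) :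
    ∀ (a b : G) (φ : Fin (n + 1) → ℝ),
      latticeSymm (ρ (a * b)) (ε (a * b)) φ = latticeSymm (ρ a) (ε a) (latticeSymm (ρ b) (ε b) φ) :=
  fun a b φ => latticeSymm_hom_mul ρ ε a b φ

/-! ## §1 Acceptance, effective sample size, orbit cover -/

/-- **THE AVERAGED FLOW NEVER REJECTS MORE ON AVERAGE**: `∫ r_q̄ e^{−S} ≤ ∫ r_q̃ e^{−S}`. -/
theorem phi4LatticeAvg_meanRejection_le {lam : ℝ} (hlam : 0 < lam)
    {J : Fin (n + 1) → Fin (n + 1) → ℝ} {ρ : G →* Equiv.Perm (Fin (n + 1))}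
    (hJ : ∀ a x y, J (ρ a x) (ρ a y) = J x y) (ε : G →* ℤˣ) {q : (Fin (n + 1) → ℝ) → ℝ}
    (hq0 : ∀ φ, 0 < q φ) (hqm : Measurable q) (hqi : Integrable q) (hq1 : ∫ φ, q φ = 1) :
    ∫ φ, (∫ φ', (1 - imhAcceptQ (gibbsWeight J lam)
        (fun ψ => (∑ a, q (latticeSymm (ρ a) (ε a) ψ)) / Fintype.card G) φ φ')
          * ((∑ a, q (latticeSymm (ρ a) (ε a) φ')) / Fintype.card G)) * gibbsWeight J lam φ
      ≤ ∫ φ, (∫ φ', (1 - imhAcceptQ (gibbsWeight J lam) q φ φ') * q φ') * gibbsWeight J lam φ :=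
  groupAvg_meanRejection_le (μ := volume) (t := fun a => latticeSymm (ρ a) (ε a))
    (latticeSymm_family_measurePreserving ρ ε) (fun φ => gibbsWeight_pos J lam φ)
    (continuous_gibbsWeight J lam).measurable (integrable_gibbsWeight hlam J)
    (latticeSymm_family_gibbsWeight hJ ε lam) hq0 hqm hqi hq1

/-- **THE AVERAGED FLOW'S IMPORTANCE-WEIGHT MOMENT IS NO LARGER**: `W₂(q̃) < ∞ ⇒ W₂(q̄) ≤ W₂(q̃)`
(`W₂(q) = ∫ (e^{−S}/q) e^{−S}`; the i.i.d. effective sample size `Z²/W₂` never drops). -/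
theorem phi4LatticeAvg_weightMoment_le {J : Fin (n + 1) → Fin (n + 1) → ℝ}
    {ρ : G →* Equiv.Perm (Fin (n + 1))} (hJ : ∀ a x y, J (ρ a x) (ρ a y) = J x y) (ε : G →* ℤˣ)
    (lam : ℝ) {q : (Fin (n + 1) → ℝ) → ℝ} (hq0 : ∀ φ, 0 < q φ) (hqm : Measurable q)
    (hW : Integrable (fun φ => gibbsWeight J lam φ / q φ * gibbsWeight J lam φ)) :
    Integrable (fun φ => gibbsWeight J lam φ
        / ((∑ a, q (latticeSymm (ρ a) (ε a) φ)) / Fintype.card G) * gibbsWeight J lam φ) ∧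
    ∫ φ, gibbsWeight J lam φ / ((∑ a, q (latticeSymm (ρ a) (ε a) φ)) / Fintype.card G)
        * gibbsWeight J lam φ
      ≤ ∫ φ, gibbsWeight J lam φ / q φ * gibbsWeight J lam φ :=
  groupAvg_weightMoment_le (μ := volume) (t := fun a => latticeSymm (ρ a) (ε a))
    (latticeSymm_family_measurePreserving ρ ε) (fun φ => gibbsWeight_pos J lam φ)
    (continuous_gibbsWeight J lam).measurable (latticeSymm_family_gibbsWeight hJ ε lam) hq0 hqm hW

/-- **A FLOW COVERING ONE SYMMETRY IMAGE OF EVERY CONFIGURATION, AVERAGED, IS UNIFORMLY ERGODIC ON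
`PolyObs`**: `∀ φ ∃ a, e^{−S(φ)} ≤ C q̃(t_a φ)` ⇒ for every `g ∈ PolyObs` with `∫ g e^{−S} = 0` and
`∫ g² e^{−S} > 0`, the normalised series under the averaged arm is summable and
`τ_int ≤ |G| C/Z − ½`. -/
theorem phi4LatticeAvg_tauInt_le_of_orbitCover {lam : ℝ} (hlam : 0 < lam)
    (J : Fin (n + 1) → Fin (n + 1) → ℝ) (ρ : G →* Equiv.Perm (Fin (n + 1))) (ε : G →* ℤˣ)
    {q : (Fin (n + 1) → ℝ) → ℝ} (hq0 : ∀ φ, 0 < q φ) (hqm : Measurable q) (hqi : Integrable q)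
    (hq1 : ∫ φ, q φ = 1) {C : ℝ} (hC : ∀ φ, ∃ a, gibbsWeight J lam φ ≤ C * q (latticeSymm (ρ a) (ε a) φ))
    {g : (Fin (n + 1) → ℝ) → ℝ} (hg : PolyObs g) (hg0 : ∫ φ, g φ * gibbsWeight J lam φ = 0)
    (hP : 0 < ∫ φ, g φ ^ 2 * gibbsWeight J lam φ) :
    (Summable fun k => (∫ φ, g φ * ((imhOpPhi4 J lam
        (fun ψ => (∑ a, q (latticeSymm (ρ a) (ε a) ψ)) / Fintype.card G))^[k + 1] g) φ
          * gibbsWeight J lam φ) / ∫ φ, g φ ^ 2 * gibbsWeight J lam φ) ∧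
    tauInt (fun k => (∫ φ, g φ * ((imhOpPhi4 J lam
        (fun ψ => (∑ a, q (latticeSymm (ρ a) (ε a) ψ)) / Fintype.card G))^[k] g) φ
          * gibbsWeight J lam φ) / ∫ φ, g φ ^ 2 * gibbsWeight J lam φ)
      ≤ 1 / (gibbsZ J lam / (Fintype.card G * C)) - 1 / 2 := by
  obtain ⟨hgm, hg2⟩ := polyObs_sq_integrable hlam J hg
  rw [imhOpPhi4_eq_imhOp]
  exact groupAvg_tauInt_le_of_orbitCover (μ := volume) (t := fun a => latticeSymm (ρ a) (ε a))
    (latticeSymm_family_measurePreserving ρ ε) (fun φ => gibbsWeight_pos J lam φ)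
    (continuous_gibbsWeight J lam).measurable (integrable_gibbsWeight hlam J) hq0 hqm hqi hq1 hC
    hgm hg2 hg0 hP

/-! ## §2 `τ_int` on the symmetry sectors -/

/-- **Gibbs expectations are invariant: `⟨f ∘ t_{(σ,c)}⟩ = ⟨f⟩`** (`σ` a `J`-automorphism). -/
theorem gibbsExpect_comp_latticeSymm {J : Fin (n + 1) → Fin (n + 1) → ℝ}
    {σ : Equiv.Perm (Fin (n + 1))} (hJ : ∀ x y, J (σ x) (σ y) = J x y) (c : ℤˣ) (lam : ℝ)
    (f : (Fin (n + 1) → ℝ) → ℝ) :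
    gibbsExpect J lam (fun φ => f (latticeSymm σ c φ)) = gibbsExpect J lam f := by
  unfold gibbsExpect
  congr 1
  have h := (measurePreserving_latticeSymm σ c).integral_comp (latticeSymm σ c).measurableEmbedding
    (fun φ => f φ * gibbsWeight J lam φ)
  rw [← h]
  exact integral_congr_ae (Eventually.of_forall fun φ => by
    simp only [gibbsWeight_latticeSymm hJ c lam φ])

/-- **AVERAGING NEVER INCREASES `τ_int` OF A SIGN-COVARIANT POLYNOMIAL OBSERVABLE.**  `f ∈ PolyObs`,
`f (t_a φ) = χ(a)·f φ` for a multiplicative `χ : G → ℝ` with `χ(a)² = 1`, `Var f > 0`; if the normalised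
autocorrelation series of `f` under the flow arm `imhOpPhi4 J λ q̃` is summable, then under the
averaged arm `imhOpPhi4 J λ q̄` it is summable and `τ_int^{q̄}(f) ≤ τ_int^{q̃}(f)`. -/
theorem phi4LatticeAvg_tauInt_le_of_covariant {lam : ℝ} (hlam : 0 < lam)
    {J : Fin (n + 1) → Fin (n + 1) → ℝ} {ρ : G →* Equiv.Perm (Fin (n + 1))}
    (hJ : ∀ a x y, J (ρ a x) (ρ a y) = J x y) (ε : G →* ℤˣ) {q : (Fin (n + 1) → ℝ) → ℝ}
    (hq0 : ∀ φ, 0 < q φ) (hqm : Measurable q) (hqi : Integrable q) (hq1 : ∫ φ, q φ = 1)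
    {χ : G → ℝ} (hχ : ∀ a b, χ (a * b) = χ a * χ b) (hχ2 : ∀ a, χ a ^ 2 = 1)
    {f : (Fin (n + 1) → ℝ) → ℝ} (hf : PolyObs f)
    (hcov : ∀ a φ, f (latticeSymm (ρ a) (ε a) φ) = χ a * f φ)
    (hP : 0 < ∫ φ, (f φ - gibbsExpect J lam f) ^ 2 * gibbsWeight J lam φ)
    (hs : Summable fun k => (∫ φ, (f φ - gibbsExpect J lam f)
        * ((imhOpPhi4 J lam q)^[k + 1] (fun ψ => f ψ - gibbsExpect J lam f)) φ * gibbsWeight J lam φ)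
        / ∫ φ, (f φ - gibbsExpect J lam f) ^ 2 * gibbsWeight J lam φ) :
    (Summable fun k => (∫ φ, (f φ - gibbsExpect J lam f)
        * ((imhOpPhi4 J lam (fun ψ => (∑ a, q (latticeSymm (ρ a) (ε a) ψ)) / Fintype.card G))^[k + 1]
            (fun ψ => f ψ - gibbsExpect J lam f)) φ * gibbsWeight J lam φ)
        / ∫ φ, (f φ - gibbsExpect J lam f) ^ 2 * gibbsWeight J lam φ) ∧
    tauInt (fun k => (∫ φ, (f φ - gibbsExpect J lam f)
        * ((imhOpPhi4 J lam (fun ψ => (∑ a, q (latticeSymm (ρ a) (ε a) ψ)) / Fintype.card G))^[k]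
            (fun ψ => f ψ - gibbsExpect J lam f)) φ * gibbsWeight J lam φ)
        / ∫ φ, (f φ - gibbsExpect J lam f) ^ 2 * gibbsWeight J lam φ)
      ≤ tauInt (fun k => (∫ φ, (f φ - gibbsExpect J lam f)
        * ((imhOpPhi4 J lam q)^[k] (fun ψ => f ψ - gibbsExpect J lam f)) φ * gibbsWeight J lam φ)
        / ∫ φ, (f φ - gibbsExpect J lam f) ^ 2 * gibbsWeight J lam φ) := by
  obtain ⟨hgm, hg2⟩ := polyObs_sq_integrable hlam J (polyObs_sub_const hf (gibbsExpect J lam f))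
  -- the centred observable is covariant too: `⟨f⟩ = ⟨f ∘ t_a⟩ = χ(a)⟨f⟩`
  have hmean : ∀ a, gibbsExpect J lam f = χ a * gibbsExpect J lam f := fun a => by
    have h := gibbsExpect_comp_latticeSymm (hJ a) (ε a) lam f
    have e : (fun φ => f (latticeSymm (ρ a) (ε a) φ)) = fun φ => χ a * f φ := funext (hcov a)
    rw [e] at h
    calc gibbsExpect J lam f = gibbsExpect J lam (fun φ => χ a * f φ) := h.symm
      _ = χ a * gibbsExpect J lam f := by
          unfold gibbsExpect
          rw [← mul_div_assoc, ← integral_const_mul]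
          congr 1
          exact integral_congr_ae (Eventually.of_forall fun φ => by beta_reduce; ring)
  have hcov' : ∀ a φ, (fun ψ => f ψ - gibbsExpect J lam f) (latticeSymm (ρ a) (ε a) φ)
      = χ a * (fun ψ => f ψ - gibbsExpect J lam f) φ := fun a φ => by
    show f (latticeSymm (ρ a) (ε a) φ) - gibbsExpect J lam f = χ a * (f φ - gibbsExpect J lam f)
    rw [hcov, mul_sub, ← hmean a]
  rw [imhOpPhi4_eq_imhOp] at hs ⊢
  rw [imhOpPhi4_eq_imhOp]
  exact groupAvg_tauInt_le_of_covariant (μ := volume) (t := fun a => latticeSymm (ρ a) (ε a))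
    (latticeSymm_family_measurePreserving ρ ε) (latticeSymm_family_mul ρ ε)
    (fun φ => gibbsWeight_pos J lam φ) (continuous_gibbsWeight J lam).measurable
    (integrable_gibbsWeight hlam J) (latticeSymm_family_gibbsWeight hJ ε lam) hq0 hqm hqi hq1 hχ hχ2
    hgm hg2 hP hcov' hs

/-- **AVERAGING NEVER INCREASES `τ_int` OF AN INVARIANT POLYNOMIAL OBSERVABLE** (`f (t_a φ) = f φ` for
all `a`: the energy parts, `Σ φ²`, `M²`, every symmetry-averaged local observable). -/
theorem phi4LatticeAvg_tauInt_le_of_invariant {lam : ℝ} (hlam : 0 < lam)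
    {J : Fin (n + 1) → Fin (n + 1) → ℝ} {ρ : G →* Equiv.Perm (Fin (n + 1))}
    (hJ : ∀ a x y, J (ρ a x) (ρ a y) = J x y) (ε : G →* ℤˣ) {q : (Fin (n + 1) → ℝ) → ℝ}
    (hq0 : ∀ φ, 0 < q φ) (hqm : Measurable q) (hqi : Integrable q) (hq1 : ∫ φ, q φ = 1)
    {f : (Fin (n + 1) → ℝ) → ℝ} (hf : PolyObs f) (hinv : ∀ a φ, f (latticeSymm (ρ a) (ε a) φ) = f φ)
    (hP : 0 < ∫ φ, (f φ - gibbsExpect J lam f) ^ 2 * gibbsWeight J lam φ)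
    (hs : Summable fun k => (∫ φ, (f φ - gibbsExpect J lam f)
        * ((imhOpPhi4 J lam q)^[k + 1] (fun ψ => f ψ - gibbsExpect J lam f)) φ * gibbsWeight J lam φ)
        / ∫ φ, (f φ - gibbsExpect J lam f) ^ 2 * gibbsWeight J lam φ) :
    (Summable fun k => (∫ φ, (f φ - gibbsExpect J lam f)
        * ((imhOpPhi4 J lam (fun ψ => (∑ a, q (latticeSymm (ρ a) (ε a) ψ)) / Fintype.card G))^[k + 1]
            (fun ψ => f ψ - gibbsExpect J lam f)) φ * gibbsWeight J lam φ)
        / ∫ φ, (f φ - gibbsExpect J lam f) ^ 2 * gibbsWeight J lam φ) ∧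
    tauInt (fun k => (∫ φ, (f φ - gibbsExpect J lam f)
        * ((imhOpPhi4 J lam (fun ψ => (∑ a, q (latticeSymm (ρ a) (ε a) ψ)) / Fintype.card G))^[k]
            (fun ψ => f ψ - gibbsExpect J lam f)) φ * gibbsWeight J lam φ)
        / ∫ φ, (f φ - gibbsExpect J lam f) ^ 2 * gibbsWeight J lam φ)
      ≤ tauInt (fun k => (∫ φ, (f φ - gibbsExpect J lam f)
        * ((imhOpPhi4 J lam q)^[k] (fun ψ => f ψ - gibbsExpect J lam f)) φ * gibbsWeight J lam φ)
        / ∫ φ, (f φ - gibbsExpect J lam f) ^ 2 * gibbsWeight J lam φ) :=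
  phi4LatticeAvg_tauInt_le_of_covariant hlam hJ ε hq0 hqm hqi hq1 (χ := fun _ => 1)
    (fun _ _ => (one_mul 1).symm) (fun _ => one_pow 2) hf (fun a φ => by rw [hinv, one_mul]) hP hs

/-- **AVERAGING NEVER INCREASES `τ_int` OF THE MAGNETISATION** — under ANY such symmetry group, flips
included: `M (t_a φ) = ε(a)·M(φ)` puts `M` in the sign sector `χ = ε`. -/
theorem phi4LatticeAvg_tauInt_magnetisation_le {lam : ℝ} (hlam : 0 < lam)
    {J : Fin (n + 1) → Fin (n + 1) → ℝ} {ρ : G →* Equiv.Perm (Fin (n + 1))}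
    (hJ : ∀ a x y, J (ρ a x) (ρ a y) = J x y) (ε : G →* ℤˣ) {q : (Fin (n + 1) → ℝ) → ℝ}
    (hq0 : ∀ φ, 0 < q φ) (hqm : Measurable q) (hqi : Integrable q) (hq1 : ∫ φ, q φ = 1)
    (hP : 0 < ∫ φ, ((∑ x, φ x) - gibbsExpect J lam (fun ψ => ∑ x, ψ x)) ^ 2 * gibbsWeight J lam φ)
    (hs : Summable fun k => (∫ φ, ((∑ x, φ x) - gibbsExpect J lam (fun ψ => ∑ x, ψ x))
        * ((imhOpPhi4 J lam q)^[k + 1]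
            (fun ψ => (∑ x, ψ x) - gibbsExpect J lam (fun ψ => ∑ x, ψ x))) φ * gibbsWeight J lam φ)
        / ∫ φ, ((∑ x, φ x) - gibbsExpect J lam (fun ψ => ∑ x, ψ x)) ^ 2 * gibbsWeight J lam φ) :
    (Summable fun k => (∫ φ, ((∑ x, φ x) - gibbsExpect J lam (fun ψ => ∑ x, ψ x))
        * ((imhOpPhi4 J lam (fun ψ => (∑ a, q (latticeSymm (ρ a) (ε a) ψ)) / Fintype.card G))^[k + 1]
            (fun ψ => (∑ x, ψ x) - gibbsExpect J lam (fun ψ => ∑ x, ψ x))) φ * gibbsWeight J lam φ)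
        / ∫ φ, ((∑ x, φ x) - gibbsExpect J lam (fun ψ => ∑ x, ψ x)) ^ 2 * gibbsWeight J lam φ) ∧
    tauInt (fun k => (∫ φ, ((∑ x, φ x) - gibbsExpect J lam (fun ψ => ∑ x, ψ x))
        * ((imhOpPhi4 J lam (fun ψ => (∑ a, q (latticeSymm (ρ a) (ε a) ψ)) / Fintype.card G))^[k]
            (fun ψ => (∑ x, ψ x) - gibbsExpect J lam (fun ψ => ∑ x, ψ x))) φ * gibbsWeight J lam φ)
        / ∫ φ, ((∑ x, φ x) - gibbsExpect J lam (fun ψ => ∑ x, ψ x)) ^ 2 * gibbsWeight J lam φ)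
      ≤ tauInt (fun k => (∫ φ, ((∑ x, φ x) - gibbsExpect J lam (fun ψ => ∑ x, ψ x))
        * ((imhOpPhi4 J lam q)^[k]
            (fun ψ => (∑ x, ψ x) - gibbsExpect J lam (fun ψ => ∑ x, ψ x))) φ * gibbsWeight J lam φ)
        / ∫ φ, ((∑ x, φ x) - gibbsExpect J lam (fun ψ => ∑ x, ψ x)) ^ 2 * gibbsWeight J lam φ) :=
  phi4LatticeAvg_tauInt_le_of_covariant hlam hJ ε hq0 hqm hqi hq1 (χ := fun a => ((ε a : ℤ) : ℝ))
    (fun a b => by rw [map_mul, Units.val_mul, Int.cast_mul])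
    (fun a => by rw [sq, ← Int.cast_mul, Int.units_coe_mul_self, Int.cast_one])
    polyObs_magnetisation (fun a φ => magnetisation_latticeSymm (ρ a) (ε a) φ) hP hs

end Lattice

end Summit.Ventures.LatticeQCDFlow.Exactness
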